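import Literature.NumberTheory.EllipticCurves.McCallum1991.EigenclassesCebotarevLevelPow
import HarnessLib

/-!
# Crux `JetchevIrreducibleReadingByName` (item 20165): McCallum's Cor. 3.2 at level `p^M` for ANY
# image with (a non-trivial SCALAR realised by `Γ_K`, `E[p]` simple, scalar commutant) — the `-1`
# of Gross's Prop. 9.1 / Sah's lemma generalised to a scalar `a ≢ 1 (mod p)`; seat `bsd-potss-k8t-c4`
# g9; route-free; `--supports 20165`, helper; nothing booked, no item closed, BSD is not proved by this

WHY. bsd-jet's road K and the g8 cut of the crux's hardest stub `stub_thm52RowObjectsAddv`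
(`…JetchevIrreducibleReadingThm52KernelInputsIrred`, p508713) consume McCallum 1991 Cor. 3.2 at level
`p^M` — the Čebotarev statement «infinitely many Kolyvagin primes with PRESCRIBED local orders of
independent `τ`-eigenclasses» — through the displayed reading `h32I` (the typed fact
`McCallum1991.cor32_eigenclasses_infinite_primes_localOrder` with the `p`-adic tower replaced by
`W.HasIrreducibleModPGaloisRep p`). The tree PROVES the surjective fact
(`McCallum1991.cor32_eigenclasses_infinite_primes_localOrder_holds` ⟸
`exists_kolyvaginPrime_gt_pow` ⟸ Čebotarev + Weil pairing), and that proof consumes the image of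
`Γ_ℚ` EXACTLY through three properties of the `Γ_K`-module `E_p = E(K̄)[p]` (file
`HeegnerPointsKolyvaginSquares`): (N) some element of `Γ_K` acts as `-1`; (S) `E_p` is a simple
`Γ_K`-module; (C) its commutant is scalar. This file re-runs that proof with (N) WEAKENED to

  (Z) some `z ∈ Γ_K` acts on `E_p` as an integer scalar `a` with `p ∤ a - 1`

(a non-trivial homothety), i.e. it proves Cor. 3.2 at level `p^M` for every triple `(E, K, p)` whose
image has (Z), (S), (C) — with NO surjectivity, NO irreducibility binder and NO reduction binder.
This is the precise content of Jetchev 2008, Rem. 6.2 («McCallum's results … hold under the weaker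
assumption that `ρ_{E,p}` is irreducible — his arguments only use that `End(E[p])` is spanned by
Galois elements») as far as the Čebotarev lemma (his Lemma 5.1 = [McC] Cor. 3.2) is concerned: the
homothety serves Gross's Prop. 9.1 (injectivity of restriction, "this elegant proof is due to
Serre" = Sah's lemma), (S)+(C) serve Prop. 9.3 (joint surjectivity of the evaluation pairing).
The sequel files `…JetchevIrreducibleCebotarevPrimes.lean` (§4, the Čebotarev theorem itself) and
`…JetchevIrreducibleCebotarevImage.lean` use these; the latter DISCHARGES (Z), (S), (C) from
`W.HasIrreducibleModPGaloisRep p` + the Heegner hypothesis for `(N_E, K)` + `p ∣ N_E` (so that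
`K ∩ ℚ(E[p]) = ℚ`), using the tree's scalar-in-the-image theorems
`WeierstrassCurve.exists_galoisRepTorsion_eq_smul_of_not_surjective{,_three}` (Serre 1972 §2.6,
cell bsd-smallim) — whence the CORRECTED reading h32I′ is a theorem. (The reading `h32I` as
displayed in p507696/p508713, without those two binders, is FALSE when `ρ̄_{E,p}` is induced from
`K`: see the module docstring of the sequel and the seat's FINDING memo.)

WHAT (all sorry-free, route-free):
* §1 `smul_pow_eq_smul_of_smul_eq_smul_torsionBy` — (Z) on `A[p]` ⟹ `z^{p^{M-1}}` acts on
  `A[p^M]` as the scalar `a^{p^{M-1}}` (the tree's `KolyvaginPairing.Lowers` calculus: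
  `(m·z) - 1` lowers the `p`-level by one when `ma ≡ 1 (mod p)`).
* §2 `eq_zero_of_h1Eval_eq_zero_of_smul_eq` — Gross 1991 Prop. 9.1 (restriction
  `H¹(K, E[n]) → Hom(Γ_{K(E[n])}, E[n])` is injective) from a scalar `a` on `E[n]` with `a - 1`
  invertible on `E[n]` (the tree's `eq_zero_of_h1Eval_eq_zero` is `a = -1`).
* §3 `exists_h1Eval_eq_of_indep_of_smul_eq`, `exists_h1Eval_conj_mul_order_of_smul_eq` — McCallum
  (2) and Prop. 3.1/Cor. 3.2's Galois element, verbatim from `HeegnerPointsKolyvaginPrimaryPairingProofs`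
  with the `-1` input replaced by the scalar.
* (sequel file `…JetchevIrreducibleCebotarevPrimes`, §4) `exists_kolyvaginPrime_gt_pow_of_image` —
  McCallum Cor. 3.2 at level `p^M` above every bound = the tree's `exists_kolyvaginPrime_gt_pow`
  byte-for-byte with `hρ` (surjectivity mod `p`) replaced by (Z), (S), (C); and its printed /
  `Set.Infinite` shapes `cor32_pow_of_image`, `cor32_localOrder_of_image`.

HONEST FRAMING: pure re-plumbing of tree proofs under weaker hypotheses; nothing is asserted about
any curve; the crux 20165, its stubs and BSD are exactly as open as before.

References: [cite: McCallumLMS1991, §3 Prop. 3.1, Cor. 3.2 (pp. 298–299), §4 (pp. 299–300)]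
[cite: GrossLMS1991, §9 Props. 9.1, 9.3 (PDF pp. 227–228)] [cite: Jetchev2008, Lemma 5.1 (p. 821),
Rem. 6.2] [cite: Sah1968, Prop. 2.7 (b)] [cite: Serre1972, §2.6].
-/

set_option autoImplicit false
-- the Theorems directory repeats the summit name (sibling precedent `KatoDescentPotSupersingularAssembly.lean`)
set_option linter.dupNamespace false

noncomputable section

open scoped Classical Pointwise
open WeierstrassCurve NumberField IsDedekindDomain Field
open Literature.NumberTheory.GaloisRepresentations Literature.NumberTheory.EllipticCurves

universe u v

namespace Summit.BirchSwinnertonDyer.BirchSwinnertonDyer.Theorems.JetchevIrreducibleCebotarev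

/-! ### §1. A scalar on `A[p]` realised by `z` makes `z^{p^{M-1}}` a scalar on `A[p^M]` -/

section ScalarLift

variable {A : Type*} [AddCommGroup A] {G : Type*} [Group G] [DistribMulAction G A] {p : ℕ}

/-- **From a scalar on `A[p]` to a scalar on `A[p^M]`.** If `z` acts on the `p`-torsion of `A` as
the integer scalar `a`, `p ∤ a` (automatic for an automorphism of a non-zero `A[p]`), then
`z^{p^{M-1}}` acts on `A[p^M]` as the scalar `a^{p^{M-1}}` (`M ≥ 1`). Proof: with `m a ≡ 1 (mod p^M)`
the endomorphism `β = m·z` satisfies «`β - 1` lowers the `p`-level by one» (on `A[p^j]`,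
`p^{j-1}(m z s - s) = (m a - 1)(p^{j-1}s) = 0`), so `β^{p^{M-1}} - 1` kills `A[p^M]`
(`KolyvaginPairing.Lowers.pow_pow_sub_one`), i.e. `m^{p^{M-1}} z^{p^{M-1}} t = t`, and
`(m a)^{p^{M-1}} ≡ 1 (mod p^M)`. (Matrices: `(a + pX)^{p^{M-1}} ≡ a^{p^{M-1}} (mod p^M)`; for `a = -1`
this is the tree's `KolyvaginPairing.smul_eq_neg_of_smul_eq_neg_torsionBy`.) [folklore]
[cite: Sah1968, Prop. 2.7 (b)] -/
theorem smul_pow_eq_smul_of_smul_eq_smul_torsionBy (hp : p.Prime) {z : G} {a : ℤ}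
    (ha : ¬ (p : ℤ) ∣ a) (hz : ∀ t : A, (p : ℤ) • t = 0 → z • t = a • t) {M : ℕ} (hM : 1 ≤ M)
    {t : A} (ht : ((p : ℤ) ^ M) • t = 0) : z ^ p ^ (M - 1) • t = (a ^ p ^ (M - 1)) • t := by
  -- an inverse `m` of `a` modulo `p^M`
  have hpZ : Prime (p : ℤ) := Nat.prime_iff_prime_int.mp hp
  have hcop : IsCoprime a ((p : ℤ) ^ M) :=
    ((hpZ.irreducible.coprime_iff_not_dvd.mpr ha).symm).pow_right
  obtain ⟨m, w, hmw⟩ := hcop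
  -- `hmw : m * a + w * p^M = 1`
  set Z : AddMonoid.End A := DistribMulAction.toAddMonoidEnd G A z with hZ
  set β : AddMonoid.End A := (m : AddMonoid.End A) * Z with hβ
  have hβapp : ∀ s : A, β s = m • (z • s) := fun s ↦ by
    rw [hβ, AddMonoid.End.coe_mul, Function.comp_apply, AddMonoid.End.intCast_apply]
    rfl
  have hβpow : ∀ (N : ℕ) (s : A), (β ^ N) s = (m ^ N) • (z ^ N • s) := by
    intro N
    induction N with
    | zero => intro s; rw [pow_zero, pow_zero, pow_zero, one_smul, one_smul]; rfl
    | succ N ih =>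
      intro s
      rw [pow_succ', AddMonoid.End.coe_mul, Function.comp_apply, ih, hβapp, smul_comm z (m ^ N),
        smul_smul, ← mul_smul z, ← pow_succ', ← pow_succ']
  -- `β - 1` lowers the level by one
  have h1 : KolyvaginPairing.Lowers p (β - 1) 1 := fun j s hs ↦ by
    change ((p : ℤ) ^ (j - 1)) • (β s - s) = 0
    rcases Nat.eq_zero_or_pos j with rfl | hj
    · rw [pow_zero, one_smul] at hs
      rw [hs, map_zero, sub_zero, smul_zero]
    · set s' := ((p : ℤ) ^ (j - 1)) • s with hs'def
      have hs' : (p : ℤ) • s' = 0 := by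
        rw [hs'def, smul_smul, ← pow_succ', Nat.sub_add_cancel hj, hs]
      have hpow : (p : ℤ) ^ M = (p : ℤ) ^ (M - 1) * p := by
        rw [← pow_succ, Nat.sub_add_cancel hM]
      have hma : m * a - 1 = -(w * (p : ℤ) ^ (M - 1)) * p := by
        linear_combination hmw - w * hpow
      calc ((p : ℤ) ^ (j - 1)) • (β s - s)
          = m • (z • s') - s' := by
            rw [hβapp, smul_sub, smul_comm ((p : ℤ) ^ (j - 1)) m, smul_comm ((p : ℤ) ^ (j - 1)) z]
        _ = (m * a - 1) • s' := by rw [hz _ hs', smul_smul, sub_smul, one_smul]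
        _ = 0 := by rw [hma, mul_smul, hs', smul_zero]
  have h2 := (h1.pow_pow_sub_one (M - 1)) M t ht
  rw [Nat.sub_add_cancel hM, Nat.sub_self, pow_zero, one_smul] at h2
  -- `h2 : (β ^ p ^ (M-1) - 1) t = 0`
  set k : ℕ := p ^ (M - 1) with hk
  have h3 : (m ^ k) • (z ^ k • t) = t := by
    have : (β ^ k - 1) t = (β ^ k) t - t := rfl
    rw [this, sub_eq_zero, hβpow] at h2
    exact h2
  -- `(m a)^k ≡ 1 (mod p^M)`
  have hmod : ((p : ℤ) ^ M) ∣ (m * a) ^ k - 1 := by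
    have h1' : 1 ≡ m * a [ZMOD ((p : ℤ) ^ M)] :=
      Int.modEq_iff_dvd.mpr ⟨-w, by linear_combination hmw⟩
    have h2' := h1'.pow k
    rw [one_pow] at h2'
    exact Int.modEq_iff_dvd.mp h2'
  obtain ⟨q, hq⟩ := hmod
  have hkill : ((p : ℤ) ^ M) • (z ^ k • t) = 0 := by
    rw [smul_comm ((p : ℤ) ^ M) (z ^ k) t, ht, smul_zero]
  calc z ^ k • t = (1 + ((p : ℤ) ^ M) * q) • (z ^ k • t) := by
        rw [add_smul, one_smul, mul_comm, mul_smul, hkill, smul_zero, add_zero]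
    _ = ((m * a) ^ k) • (z ^ k • t) := by
        rw [show (m * a) ^ k = 1 + (p : ℤ) ^ M * q by linear_combination hq]
    _ = (a ^ k) • ((m ^ k) • (z ^ k • t)) := by rw [mul_pow, smul_smul, mul_comm]
    _ = (a ^ k) • t := by rw [h3]

/-- `a^{p^j} ≡ a (mod p)` (Fermat), in divisibility form. [folklore] -/
theorem prime_dvd_pow_prime_pow_sub (hp : p.Prime) (a : ℤ) (j : ℕ) :
    (p : ℤ) ∣ a ^ p ^ j - a := by
  haveI : Fact p.Prime := ⟨hp⟩
  rw [← ZMod.intCast_zmod_eq_zero_iff_dvd, Int.cast_sub, Int.cast_pow, sub_eq_zero]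
  induction j with
  | zero => rw [pow_zero, pow_one]
  | succ j ih => rw [pow_succ, pow_mul, ih, ZMod.pow_card]

end ScalarLift

/-! ### §2. Gross 1991, Prop. 9.1 from a non-trivial scalar (Sah) -/

section Eval

variable {K : Type u} [Field K] (W : WeierstrassCurve K) (n : ℤ)

/-- **Gross 1991, Prop. 9.1 (injectivity of restriction) from a SCALAR in the image.** If some
`z ∈ Γ_K` acts on `E[n]` as the integer scalar `a` and `a - 1` is invertible on `E[n]`
(`(m (a - 1)) P = P`), then a class `x ∈ H¹(K, E[n])` with `[x, ρ] = 0` for all `ρ ∈ Γ_{K(E[n])}`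
vanishes. Proof on cocycles (Serre/Sah): `zg = gz·n₀` with `n₀ = z⁻¹g⁻¹zg ∈ Γ_{K(E[n])}` (`z` is
central modulo the kernel since it acts as a scalar), so `f(z) + a f(g) = f(zg) = f(gz n₀) = f(g) + g f(z)`,
i.e. `(a - 1) f(g) = (g - 1) f(z)` and `f` is the coboundary of `m f(z)`. The tree's
`eq_zero_of_h1Eval_eq_zero` is the case `a = -1`. [cite: GrossLMS1991, Prop. 9.1]
[cite: Sah1968, Prop. 2.7 (b)] -/
theorem eq_zero_of_h1Eval_eq_zero_of_smul_eq {z : absoluteGaloisGroup K} {a : ℤ}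
    (hz : ∀ P : geomTorsion W n, z • P = a • P)
    {m : ℤ} (hm : ∀ P : geomTorsion W n, (m * (a - 1)) • P = P) {x : galH1Torsion W n}
    (hx : ∀ ρ ∈ torsionFixing W n, h1Eval W n x ρ = 0) : x = 0 := by
  rw [← oneCocycleClass_reprCocycle W n x]
  set φ := reprCocycle W n x with hφ
  refine (oneCocycleClass_eq_zero_iff _ φ).mpr ⟨m • φ.1 z, fun g ↦ ?_⟩
  -- `z⁻¹` acts as a scalar inverse to `a`: `a • (z⁻¹ • Q) = Q`
  have hz' : ∀ Q : geomTorsion W n, a • (z⁻¹ • Q) = Q := fun Q ↦ by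
    rw [← hz (z⁻¹ • Q), smul_inv_smul]
  -- `n₀ = z⁻¹ g⁻¹ z g` acts trivially on `E[n]`
  have hn₀ : z⁻¹ * g⁻¹ * z * g ∈ torsionFixing W n := by
    refine (mem_torsionFixing_iff W n).mpr fun P ↦ ?_
    rw [mul_smul, mul_smul, mul_smul, hz, smul_comm g⁻¹ a, inv_smul_smul, smul_comm z⁻¹ a, hz']
  have hzg : z * g = g * z * (z⁻¹ * g⁻¹ * z * g) := by group
  have h1 := φ.2 z g
  have h2 := φ.2 (g * z) (z⁻¹ * g⁻¹ * z * g)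
  have h3 := φ.2 g z
  rw [discreteTopRep_ρ_apply] at h1 h2 h3
  have h4 : φ.1 (z⁻¹ * g⁻¹ * z * g) = 0 := hx _ hn₀
  rw [← hzg, h1, h4, smul_zero, add_zero, h3, hz] at h2
  -- `h2 : φ z + a • φ g = φ g + g • φ z`
  have key : (a - 1) • φ.1 g = g • φ.1 z - φ.1 z := by
    rw [sub_smul, one_smul]
    rw [← sub_eq_zero] at h2 ⊢
    have e : a • φ.1 g - φ.1 g - (g • φ.1 z - φ.1 z) = φ.1 z + a • φ.1 g - (φ.1 g + g • φ.1 z) := by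
      abel
    rw [e, h2]
  have hcomm : g • (m • φ.1 z) = m • (g • φ.1 z) :=
    map_zsmul (DistribSMul.toAddMonoidHom (geomTorsion W n) g) m _
  rw [discreteTopRep_ρ_apply, hcomm, ← zsmul_sub, ← key, smul_smul, hm]

end Eval

/-! ### §3. McCallum (2) and the Galois element of Prop. 3.1 / Cor. 3.2, from a scalar -/

section Surjective

variable {K : Type u} [Field K] (W : WeierstrassCurve K)

/-- **McCallum 1991, (2) / Gross 1991, Prop. 9.3 modulo `p^M`, from a scalar**: the evaluations at
independent classes of `H¹(K, E[n])` are jointly surjective onto `∏ E[n][p^{eᵢ}]`, under: `E[p]` a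
simple `Γ_K`-module with scalar commutant, some `z ∈ Γ_K` acting on `E[n]` as a scalar `a` with
`a - 1` invertible on `E[n]`. = the tree's `exists_h1Eval_eq_of_indep` with its `-1`/`2⁻¹` inputs
replaced by `a`/`(a-1)⁻¹` (they enter only through Prop. 9.1). [cite: McCallumLMS1991, §3 (2)]
[cite: GrossLMS1991, Prop. 9.3] -/
theorem exists_h1Eval_eq_of_indep_of_smul_eq {p : ℕ} (hp : p.Prime) {n : ℤ} (hpn : (p : ℤ) ∣ n)
    (hS : ∀ H : AddSubgroup (geomTorsion W p),
      (∀ g : absoluteGaloisGroup K, ∀ t ∈ H, g • t ∈ H) → H = ⊥ ∨ H = ⊤)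
    (hC : ∀ f : geomTorsion W p →+ geomTorsion W p,
      (∀ (g : absoluteGaloisGroup K) (t : geomTorsion W p), f (g • t) = g • f t) →
        ∃ k : ℤ, ∀ t, f t = k • t)
    {z : absoluteGaloisGroup K} {a : ℤ} (hz : ∀ P : geomTorsion W n, z • P = a • P)
    {m : ℤ} (hm : ∀ P : geomTorsion W n, (m * (a - 1)) • P = P)
    {ι : Type*} [Fintype ι] (xs : ι → galH1Torsion W n) (e : ι → ℕ)
    (he : ∀ i, ((p : ℤ) ^ e i) • xs i = 0)
    (hind : ∀ c : ι → ℤ, ∑ i, c i • xs i = 0 → ∀ i, ((p : ℤ) ^ e i) ∣ c i)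
    (t : ι → geomTorsion W n) (ht : ∀ i, ((p : ℤ) ^ e i) • t i = 0) :
    ∃ ρ ∈ torsionFixing W n, ∀ i, h1Eval W n (xs i) ρ = t i := by
  set ι₁ : geomTorsion W p →+ geomTorsion W n :=
    AddSubgroup.inclusion (W.geomTorsion_le_of_dvd hpn) with hι₁
  have hιG : ∀ (g : absoluteGaloisGroup K) (s : geomTorsion W p), ι₁ (g • s) = g • ι₁ s :=
    fun _ _ ↦ rfl
  have hrange : ∀ s : geomTorsion W n, (p : ℤ) • s = 0 → ∃ s₁, ι₁ s₁ = s := fun s hs ↦ by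
    refine ⟨⟨(s : geomPoints W), ?_⟩, rfl⟩
    rw [mem_geomTorsion_iff]
    have := congrArg (fun x : geomTorsion W n ↦ (x : geomPoints W)) hs
    simpa using this
  have hfull := KolyvaginPairing.eq_piTors_of_stable_of_indep hp hS hC ι₁ hιG hrange
    (Finset.univ.sup e) (fun i ↦ Finset.le_sup (Finset.mem_univ i)) (jointRangeN W n xs)
    (fun g m hm ↦ smul_mem_jointRangeN W n xs g hm) (fun m hm i ↦ ?_) (fun c hc ↦ ?_)
  · have : t ∈ jointRangeN W n xs := by rw [hfull]; exact ht
    exact this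
  · obtain ⟨ρ, hρ, hm⟩ := hm
    rw [← hm i, ← h1Eval_zsmul W n _ _ hρ, he i, h1Eval_zero W n hρ]
  · refine hind c (eq_zero_of_h1Eval_eq_zero_of_smul_eq W n hz hm fun ρ hρ ↦ ?_)
    rw [h1Eval_sum W n _ _ hρ]
    simp only [h1Eval_zsmul W n _ _ hρ]
    exact hc _ ⟨ρ, hρ, fun i ↦ rfl⟩

end Surjective

section Conj

variable {k : Type v} {K : Type u} [Field k] [Field K] [Algebra k K] (W : WeierstrassCurve k)
variable {σ : K ≃ₐ[k] K} {τ : AlgebraicClosure K ≃+* AlgebraicClosure K}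

/-- **McCallum 1991, Prop. 3.1 / Cor. 3.2 — the Galois element with prescribed orders, modulo `p^M`,
from a scalar.** = the tree's `IsLiftOfAut.exists_h1Eval_conj_mul_order` with the input «some
element of `Γ_K` acts as `-1` on `E[n]`» replaced by «some `z ∈ Γ_K` acts on `E[n]` as a scalar `a`
with `a - 1` invertible on `E[n]`» (it enters only through the joint surjectivity of §3); `2` must
still be invertible on `E[n]` (the eigenvector step `[x_i, ρ^τρ] = 2 p^{M-N_i} e_{ν_i}`).
[cite: McCallumLMS1991, Prop. 3.1 and Cor. 3.2 (proofs)] -/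
theorem exists_h1Eval_conj_mul_order_of_smul_eq [W.IsElliptic] (hτ : IsLiftOfAut σ τ)
    (hinv : ∀ x, τ (τ x) = x) {p : ℕ} (hp : p.Prime) {n : ℤ} (hpn : (p : ℤ) ∣ n) {M : ℕ}
    (hS : ∀ H : AddSubgroup (geomTorsion (W.baseChange K) p),
      (∀ g : absoluteGaloisGroup K, ∀ t ∈ H, g • t ∈ H) → H = ⊥ ∨ H = ⊤)
    (hC : ∀ f : geomTorsion (W.baseChange K) p →+ geomTorsion (W.baseChange K) p,
      (∀ (g : absoluteGaloisGroup K) (t : geomTorsion (W.baseChange K) p), f (g • t) = g • f t) →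
        ∃ k : ℤ, ∀ t, f t = k • t)
    {z : absoluteGaloisGroup K} {a : ℤ} (hz : ∀ P : geomTorsion (W.baseChange K) n, z • P = a • P)
    {m : ℤ} (hm : ∀ P : geomTorsion (W.baseChange K) n, (m * (a - 1)) • P = P)
    {u : ℤ} (hu : ∀ P : geomTorsion (W.baseChange K) n, (2 * u) • P = P)
    {ePlus eMinus : geomTorsion (W.baseChange K) n} (hePlus : hτ.torsionMap W n ePlus = ePlus)
    (heMinus : hτ.torsionMap W n eMinus = -eMinus)
    (hPlusM : ((p : ℤ) ^ M) • ePlus = 0) (hMinusM : ((p : ℤ) ^ M) • eMinus = 0)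
    (hPlus0 : ((p : ℤ) ^ (M - 1)) • ePlus ≠ 0) (hMinus0 : ((p : ℤ) ^ (M - 1)) • eMinus ≠ 0)
    {ι : Type*} [Fintype ι] {xs : ι → galH1Torsion (W.baseChange K) n} {ν : ι → ℤ}
    (hν : ∀ i, ν i = 1 ∨ ν i = -1) (hxs : ∀ i, conjAct W σ n (xs i) = ν i • xs i)
    (e : ι → ℕ) (he : ∀ i, ((p : ℤ) ^ e i) • xs i = 0)
    (hind : ∀ c : ι → ℤ, ∑ i, c i • xs i = 0 → ∀ i, ((p : ℤ) ^ e i) ∣ c i)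
    (Nv : ι → ℕ) (hNe : ∀ i, Nv i ≤ e i) (hNM : ∀ i, Nv i ≤ M) :
    ∃ ρ ∈ torsionFixing (W.baseChange K) n, ∀ m' ∈ evalKer (W.baseChange K) n xs, ∀ i,
      ((p : ℤ) ^ Nv i) • h1Eval (W.baseChange K) n (xs i) (hτ.conjGalCMH (ρ * m') * (ρ * m')) = 0 ∧
      (Nv i ≠ 0 →
        ((p : ℤ) ^ (Nv i - 1)) •
            h1Eval (W.baseChange K) n (xs i) (hτ.conjGalCMH (ρ * m') * (ρ * m')) ≠ 0) := by
  -- target values `t_i = p^{M - N_i} e_{ν_i}`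
  set ev : ι → geomTorsion (W.baseChange K) n := fun i ↦ if ν i = 1 then ePlus else eMinus with hev
  have hevτ : ∀ i, hτ.torsionMap W n (ev i) = ν i • ev i := fun i ↦ by
    rcases hν i with h | h
    · simp [hev, h, hePlus]
    · simp [hev, h, heMinus]
  have hevM : ∀ i, ((p : ℤ) ^ M) • ev i = 0 := fun i ↦ by
    by_cases h : ν i = 1 <;> simp [hev, h, hPlusM, hMinusM]
  have hev0 : ∀ i, ((p : ℤ) ^ (M - 1)) • ev i ≠ 0 := fun i ↦ by
    by_cases h : ν i = 1 <;> simp [hev, h, hPlus0, hMinus0]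
  set t : ι → geomTorsion (W.baseChange K) n := fun i ↦ ((p : ℤ) ^ (M - Nv i)) • ev i with htdef
  have ht : ∀ i, ((p : ℤ) ^ e i) • t i = 0 := fun i ↦ by
    simp only [htdef]
    rw [smul_smul, ← pow_add]
    have : e i + (M - Nv i) = (e i - Nv i) + M := by have := hNe i; have := hNM i; omega
    rw [this, pow_add, mul_smul, hevM, smul_zero]
  obtain ⟨ρ, hρ, hρe⟩ :=
    exists_h1Eval_eq_of_indep_of_smul_eq (W.baseChange K) hp hpn hS hC hz hm xs e he hind t ht
  refine ⟨ρ, hρ, fun m' hm' i ↦ ?_⟩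
  have hρm : ρ * m' ∈ torsionFixing (W.baseChange K) n := mul_mem hρ hm'.1
  have hνν : ν i * ν i = 1 := by rcases hν i with h | h <;> simp [h]
  have hval : h1Eval (W.baseChange K) n (xs i) (hτ.conjGalCMH (ρ * m') * (ρ * m')) =
      (2 : ℤ) • t i := by
    rw [h1Eval_mul _ _ _ (hτ.conjGalCMH_mem_torsionFixing W hinv _ hρm),
      hτ.h1Eval_conjGalCMH_of_eigen W hinv _ (hν i) (hxs i) hρm, h1Eval_mul _ _ _ hρ, hρe i,
      hm'.2 i, add_zero]
    simp only [htdef]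
    rw [map_zsmul, hevτ, smul_smul, smul_smul, mul_comm (ν i), mul_assoc, hνν, mul_one, two_smul]
  have hA : ((p : ℤ) ^ Nv i) • t i = 0 := by
    simp only [htdef]
    rw [smul_smul, ← pow_add, Nat.add_sub_cancel' (hNM i), hevM]
  have hB : Nv i ≠ 0 → ((p : ℤ) ^ (Nv i - 1)) • t i ≠ 0 := fun hN ↦ by
    simp only [htdef]
    rw [smul_smul, ← pow_add]
    have : Nv i - 1 + (M - Nv i) = M - 1 := by have := hNM i; omega
    rw [this]
    exact hev0 i
  rw [hval]
  constructor
  · rw [smul_comm ((p : ℤ) ^ Nv i) (2 : ℤ) (t i), hA, smul_zero]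
  · intro hN h0
    rw [smul_comm ((p : ℤ) ^ (Nv i - 1)) (2 : ℤ) (t i)] at h0
    exact two_zsmul_ne_zero hu (hB hN) h0

end Conj


end Summit.BirchSwinnertonDyer.BirchSwinnertonDyer.Theorems.JetchevIrreducibleCebotarev

end
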